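import Summits.Ventures.PercRepro.C041TriangleSeedMid
import Summits.Ventures.PercRepro.C041TriangleSeedMidCell4
import Summits.Ventures.PercRepro.C041TriangleSeedMidCell5
import Summits.Ventures.PercRepro.C041TriangleSeedMidCell6
import Summits.Ventures.PercRepro.C041TriangleSeedMidCell7
import Summits.Ventures.PercRepro.C041TriangleSeedMidCell8

/-!
# THE MARK AGAINST EVERY STAR WITH AT LEAST FOUR LEAVES IN `[1/4, 1/2]` (mine-3, gen 63; C-041.md §21 (ax))

The five cells `m = 4, …, 8` (`C041TriangleSeedMidCell4` … `MidCell8`) and the infinite family `m ≥ 9` (`C041TriangleSeedMid`)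
assemble into one statement: `θ_△(v 1, V a) ∈ cone` for every star `a : Fin m → ℝ` with `4 ≤ m` leaves all in `[1/4, 1/2]`
(`InCone_thetaTri_v1_mid_all`).  Nothing is fitted here; the proof is a case split on `m`.
-/

namespace PercRepro

namespace RelaxedTriangle

open TreeClosure

/-- **THEOREM (THE MARK AGAINST EVERY STAR OF `m ≥ 4` LEAVES IN `[1/4, 1/2]`)**: `θ_△(v 1, V a) ∈ cone`. -/
theorem InCone_thetaTri_v1_mid_all {m : ℕ} (hm : 4 ≤ m) (a : Fin m → ℝ) (ha : ∀ i, 1 / 4 ≤ a i ∧ a i ≤ 1 / 2) :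
    InCone (thetaTri (v 1) (V a)) := by
  rcases Nat.lt_or_ge m 9 with h | h
  · interval_cases m
    · exact InCone_thetaTri_v1_mid4 a ha
    · exact InCone_thetaTri_v1_mid5 a ha
    · exact InCone_thetaTri_v1_mid6 a ha
    · exact InCone_thetaTri_v1_mid7 a ha
    · exact InCone_thetaTri_v1_mid8 a ha
  · exact InCone_thetaTri_v1_mid h a ha

end RelaxedTriangle

end PercRepro
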